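import Literature.Probability.LatticeModels.KCObservableBulkBounds
import Literature.Probability.LatticeModels.SeamGauge
import HarnessLib

/-!
# Sup and Lipschitz bounds for the spin fermion near its seam (gauged branch)

Topic `Literature/Probability/LatticeModels`; companion of `KCObservableBulkBounds.lean` (bounds in
the seam-free bulk) using the quadrant gauge of `SeamGauge.lean`: on a bulk region that misses the
source plaquette's neighbourhood and the vertical ray going down from it (but may meet the seam),
the re-signed section `G = seamChiS p₀ · kcObs` is s-holomorphic at every corner, so the generic
chain (`KCObservableL2Bound` → `HarmonicBulkSup` → `HarmonicBulkLipschitz`) applies to `G`: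
`‖G‖ = ‖F‖` pointwise, and `G` is the consistent local branch of the spinor
(Chelkak–Hongler–Izyurov 2015, Thm 3.12 on the double cover).

* `vLowSign_empty_of_source`: for the one-point observable the vertical lower sign is `+1` exactly
  on the seam (`x 1 = p₀ 1 ∧ p₀ 0 < x 0`) and `-1` elsewhere, along any usable dual walk from the
  source (`vLowSign_eq_of_source`);
* `KCBulkG` (bulk hypotheses without seam-freeness, with the sign values and the exclusion of the
  down-ray), `KCBulkG.isSHolAt_seamGaugeS`;
* **`norm_kcObs_le_of_gaugedBulk`**, **`norm_sub_seamGaugeS_le_of_gaugedBulk`**.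

Everything is proved; no named fact.

## References

* D. Chelkak, C. Hongler, K. Izyurov, Ann. of Math. 181 (2015): Prop. 2.4, Thm 3.12
  [ChelkakHonglerIzyurovAnnals2015].
-/

noncomputable section

namespace Literature.Probability.LatticeModels

open Finset Real SimpleGraph Complex

variable (G₂ : SimpleGraph (Site 2)) [G₂.LocallyFinite]

/-- **The vertical lower sign of the one-point observable**: `+1` exactly on the seam. [cite: ChelkakHonglerIzyurovAnnals2015, Prop. 2.4] -/
theorem vLowSign_empty_of_source {Λ : Finset (Site 2)} (hG : ∀ v ∈ Λ, ∀ k : Fin 4, G₂.Adj v (v + cornerUnit k))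
    (hle : G₂ ≤ zdGraph 2) {cut : Site 2 → Finset (Sym2 (Site 2))} {P : Set (Site 2)}
    (h : IsKCCuts G₂ Λ cut P) (hP : ↑(touchPlaquettes Λ) ⊆ P) {p₀ : Site 2} (h0 : cut p₀ = ∅)
    {x : Site 2} (W : (zdGraph 2).Walk p₀ (faceAt x 1)) (hW : UsableWalk Λ W) :
    vLowSign ∅ cut x = if (x 1 = p₀ 1 ∧ p₀ 0 < x 0) then 1 else -1 := by
  rw [vLowSign_eq_of_source G₂ (B := ∅) hG hle h hP h0 W hW]
  have hr : rowSign ∅ (x 1) = 1 := by simp [rowSign]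
  rw [hr, mul_one]
  by_cases hs : x 1 = p₀ 1 ∧ p₀ 0 < x 0
  · rw [if_pos hs, if_pos (show p₀ ∈ leftStrip x from ⟨hs.1.symm, hs.2⟩)]; norm_num
  · rw [if_neg hs, if_neg (show p₀ ∉ leftStrip x from fun hm => hs ⟨hm.1.symm, hm.2⟩)]; norm_num

/-- `‖χ F‖ = ‖F‖`. [folklore] -/
theorem norm_seamGaugeS (F : MedialVertex → ℂ) (p₀ : Site 2) (e : MedialVertex) : ‖seamGaugeS F p₀ e‖ = ‖F e‖ := by
  unfold seamGaugeS
  have h1 : seamChiS p₀ e = 1 ∨ seamChiS p₀ e = -1 := by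
    unfold seamChiS; split_ifs
    · exact seamSgnS_cases p₀ _
    · exact seamSgnS_cases p₀ _
    · simp
  rcases h1 with h | h <;> rw [h] <;> simp

/-- **Gauged bulk hypotheses** on a finite set `S` of sites for the one-point observable (`B = ∅`):
free sites with their four bonds in the domain graph, plaquettes in the cut system with touching
sides and odd cut parity, the values of the vertical lower sign (from the source), and the
exclusion of the down-ray column `x 0 = p₀ 0 + 1, x 1 ≤ p₀ 1 + 1` (which contains the source
corner's site). [cite: ChelkakHonglerIzyurovAnnals2015, §3.3] -/
structure KCBulkG (Λ : Finset (Site 2)) (cut : Site 2 → Finset (Sym2 (Site 2))) (P : Set (Site 2)) (p₀ : Site 2)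
    (S : Finset (Site 2)) : Prop where
  mem : ∀ x ∈ S, x ∈ Λ
  bd : ∀ x ∈ S, edgeBoundary G₂ {x} = Finset.univ.image fun k : Fin 4 => cSrc (x, k)
  faces : ∀ x ∈ S, ∀ k : Fin 4, faceAt x k ∈ P
  sides : ∀ f ∈ S, ∀ j : Fin 4, s(f + cornerOff j, f + cornerOff j + cornerUnit j) ∈ edgesTouching G₂ Λ
  odd : ∀ f ∈ S, Odd #(Finset.univ.filter fun j : Fin 4 => s(f + cornerOff j, f + cornerOff j + cornerUnit j) ∈ cut f)
  vsign : ∀ x ∈ S, vLowSign ∅ cut (x + cornerUnit 3) = if ((x + cornerUnit 3) 1 = p₀ 1 ∧ p₀ 0 < (x + cornerUnit 3) 0) then 1 else -1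
  ray : ∀ x ∈ S, ¬(x 0 = p₀ 0 + 1 ∧ x 1 ≤ p₀ 1 + 1)

variable {G₂}
variable {Λ : Finset (Site 2)} {η : SpinConfig (Site 2)} {cut : Site 2 → Finset (Sym2 (Site 2))} {P : Set (Site 2)} {p₀ : Site 2}

/-- **The gauged section is s-holomorphic at the four corners of a gauged-bulk site** whose west
and south neighbours are gauged-bulk sites too. [cite: ChelkakHonglerIzyurovAnnals2015, Prop. 2.4] -/
theorem KCBulkG.isSHolAt_seamGaugeS {S : Finset (Site 2)} (h : KCBulkG G₂ Λ cut P p₀ S) (hc : IsKCCuts G₂ Λ cut P)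
    (hG : ∀ v ∈ Λ, ∀ k : Fin 4, G₂.Adj v (v + cornerUnit k)) (hle : G₂ ≤ zdGraph 2)
    {y : Site 2} (hy : y ∈ S) (hyW : y + cornerUnit 2 ∈ S) (hyS : y + cornerUnit 3 ∈ S) (k : Fin 4) :
    IsSHolAt (seamGaugeS (kcObs G₂ Λ η ∅ cut) p₀) (y, k) := by
  obtain ⟨w0, wf0, wf3, -⟩ := westSite_facts y
  obtain ⟨s0, sf1, sf0, -⟩ := southSite_facts y
  have hP := h.faces y hy
  have hs0 : (y + cornerUnit 3) 0 = y 0 := by simp [cornerUnit]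
  have hs1 : (y + cornerUnit 3) 1 = y 1 - 1 := by simp [cornerUnit]; ring
  have hV : vLowSign ∅ cut (y + cornerUnit 3) = if (y 1 = p₀ 1 + 1 ∧ p₀ 0 + 1 ≤ y 0) then 1 else -1 := by
    rw [h.vsign y hy]
    by_cases hs : y 1 = p₀ 1 + 1 ∧ p₀ 0 + 1 ≤ y 0
    · rw [if_pos hs, if_pos (by rw [hs0, hs1]; omega)]
    · rw [if_neg hs, if_neg (by rw [hs0, hs1]; omega)]
  fin_cases k
  · obtain ⟨he, hstep⟩ := hc.step_gaugeEquiv G₂ (h.mem y hy) 1 (hP 1) (by rw [show (1 : Fin 4) + 3 = 0 from rfl]; exact hP 0)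
    rw [show (1 : Fin 4) + 3 = 0 from rfl] at hstep
    exact isSHolAt_seamGaugeS_zero G₂ hG hle p₀ (hc.subset _ (hP 1)) he hstep
  · have h1 : faceAt (y + cornerUnit 2) 0 ∈ P := by rw [wf0]; exact hP 1
    have h2 : faceAt (y + cornerUnit 2) (0 + 3) ∈ P := by rw [show (0 : Fin 4) + 3 = 3 from rfl, wf3]; exact hP 2
    obtain ⟨he, hstep⟩ := hc.step_gaugeEquiv G₂ (h.mem _ hyW) 0 h1 h2
    rw [show (0 : Fin 4) + 3 = 3 from rfl, wf0, wf3] at hstep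
    simp only [cSrc] at he hstep
    have hray := h.ray y hy
    exact isSHolAt_seamGaugeS_one G₂ hG hle p₀ (hc.subset _ (hP 1)) he hstep (by omega)
  · have h1 : faceAt (y + cornerUnit 3) 1 ∈ P := by rw [sf1]; exact hP 2
    have h2 : faceAt (y + cornerUnit 3) (1 + 3) ∈ P := by rw [show (1 : Fin 4) + 3 = 0 from rfl, sf0]; exact hP 3
    obtain ⟨he, hstep⟩ := hc.step_gaugeEquiv G₂ (h.mem _ hyS) 1 h1 h2
    rw [show (1 : Fin 4) + 3 = 0 from rfl, sf1, sf0] at hstep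
    simp only [cSrc] at he hstep
    exact isSHolAt_seamGaugeS_two G₂ hG hle p₀ (hc.subset _ (hP 2)) he hstep (hLowSign_empty _) hV (h.ray y hy)
  · obtain ⟨he, hstep⟩ := hc.step_gaugeEquiv G₂ (h.mem y hy) 0 (hP 0) (by rw [show (0 : Fin 4) + 3 = 3 from rfl]; exact hP 3)
    rw [show (0 : Fin 4) + 3 = 3 from rfl] at hstep
    exact isSHolAt_seamGaugeS_three G₂ hG hle p₀ (hc.subset _ (hP 0)) he hstep (hLowSign_empty _) hV

/-- **Sup bound near the seam (gauged bulk)**: as `norm_kcObs_le_of_bulk`, for the one-point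
observable, on a gauged-bulk ball. [cite: ChelkakHonglerIzyurovAnnals2015, Thm 3.12] -/
theorem norm_kcObs_le_of_gaugedBulk {Hw Hb : Site 2 → ℝ} (h : IsKCPrimitive G₂ Λ criticalBetaTwo (.fixed η) ∅ cut Hw Hb P)
    (hc : IsKCCuts G₂ Λ cut P) (hG : ∀ v ∈ Λ, ∀ k : Fin 4, G₂.Adj v (v + cornerUnit k)) (hle : G₂ ≤ zdGraph 2)
    {a : Site 2} {p : ℕ} (hp : 8 ≤ p)
    (hbulk : KCBulkG G₂ Λ cut P p₀ (latticeBall (boxCentre a (4 * p)) (2 * (2 * (4 * p)) + 3)))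
    {M : ℝ} (hM : 0 < M)
    (hHw : ∀ x ∈ latticeBall (boxCentre a (4 * p)) (2 * (2 * (4 * p)) + 1), |Hw x| ≤ M)
    (hHb : ∀ x ∈ latticeBall (boxCentre a (4 * p)) (2 * (2 * (4 * p)) + 1), |Hb x| ≤ M)
    {x : Site 2} (hx : x ∈ latticeBall (boxCentre a (4 * p)) p) {i : Fin 4} (hi : i = 0 ∨ i = 1) :
    ‖kcObs G₂ Λ η ∅ cut (cSrc (x, i))‖ ≤ kcSupConst M / Real.sqrt p := by
  set m := 4 * p with hm
  set c := boxCentre a m with hc0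
  set G := seamGaugeS (kcObs G₂ Λ η ∅ cut) p₀ with hGdef
  have hm4 : 4 ≤ m := by omega
  have hsub : ∀ {R R' : ℤ}, R ≤ R' → ∀ y ∈ latticeBall c R, y ∈ latticeBall c R' :=
    fun hRR' y hy => latticeBall_subset hRR' hy
  have hL2 := sum_norm_sq_kcObs_le G₂ h hc hG hle hm4 hbulk.mem (fun x _ => Finset.notMem_empty x) hbulk.bd hbulk.faces hbulk.sides
    hbulk.odd hM hHw hHb
  have hS : ∀ y ∈ latticeBall c (2 * (2 * m) + 2), ∀ k : Fin 4, IsSHolAt G (y, k) := by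
    intro y hy k
    exact hbulk.isSHolAt_seamGaugeS hc hG hle (hsub (by omega) y hy) (hsub (by omega) _ (add_cornerUnit_mem_latticeBall hy 2))
      (hsub (by omega) _ (add_cornerUnit_mem_latticeBall hy 3)) k
  have hharm := isLatticeHarmonicOn_edgeFun_of_isSHolAt (G := G) (c := c) (R := 2 * (2 * m)) hS i hi
  set K : ℝ := 4 * Real.sqrt 2 * kcFluxConst * M * energyGradConst with hK
  have hK0 : 0 ≤ K := by
    have := kcFluxConst_pos; have := energyGradConst_pos; positivity
  have hL2i : ∑ y ∈ latticeBall c m, ‖edgeFun G i y‖ ^ 2 ≤ K * (m : ℕ) := by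
    refine le_trans (Finset.sum_le_sum fun y _ => ?_) (le_of_le_of_eq hL2 (by rw [hK]; ring))
    simp only [edgeFun, hGdef, norm_seamGaugeS]
    rcases hi with rfl | rfl
    · exact le_add_of_nonneg_right (sq_nonneg _)
    · exact le_add_of_nonneg_left (sq_nonneg _)
  have key := norm_le_of_harmonic_of_sum_sq_le (g := edgeFun G i) (a := a) hp hharm.1 hharm.2 hK0 hL2i hx
  rw [show ‖kcObs G₂ Λ η ∅ cut (cSrc (x, i))‖ = ‖edgeFun G i x‖ by rw [edgeFun, hGdef, norm_seamGaugeS]]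
  simpa [kcSupConst, hK] using key

/-- **Lipschitz bound near the seam for the local branch** `G = seamChiS p₀ · F`. [cite: ChelkakHonglerIzyurovAnnals2015, Thm 3.12] -/
theorem norm_sub_seamGaugeS_le_of_gaugedBulk {Hw Hb : Site 2 → ℝ} (h : IsKCPrimitive G₂ Λ criticalBetaTwo (.fixed η) ∅ cut Hw Hb P)
    (hc : IsKCCuts G₂ Λ cut P) (hG : ∀ v ∈ Λ, ∀ k : Fin 4, G₂.Adj v (v + cornerUnit k)) (hle : G₂ ≤ zdGraph 2)
    {a : Site 2} {q : ℕ} (hq : 8 ≤ q)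
    (hbulk : KCBulkG G₂ Λ cut P p₀ (latticeBall (boxCentre a (4 * (2 * q))) (2 * (2 * (4 * (2 * q))) + 3)))
    {M : ℝ} (hM : 0 < M)
    (hHw : ∀ x ∈ latticeBall (boxCentre a (4 * (2 * q))) (2 * (2 * (4 * (2 * q))) + 1), |Hw x| ≤ M)
    (hHb : ∀ x ∈ latticeBall (boxCentre a (4 * (2 * q))) (2 * (2 * (4 * (2 * q))) + 1), |Hb x| ≤ M)
    {x : Site 2} (hx : x ∈ latticeBall (boxCentre a (4 * (2 * q))) q) {i : Fin 4} (hi : i = 0 ∨ i = 1) (j : Fin 4) :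
    ‖seamGaugeS (kcObs G₂ Λ η ∅ cut) p₀ (cSrc (x + cornerUnit j, i)) - seamGaugeS (kcObs G₂ Λ η ∅ cut) p₀ (cSrc (x, i))‖ ≤
      8 * topGradConst * (kcSupConst M / Real.sqrt (2 * q : ℕ)) / (2 * q : ℕ) := by
  set p := 2 * q with hp
  set m := 4 * p with hm
  set c := boxCentre a m with hc0
  set G := seamGaugeS (kcObs G₂ Λ η ∅ cut) p₀ with hGdef
  have hp8 : 8 ≤ p := by omega
  have hsub : ∀ {R R' : ℤ}, R ≤ R' → ∀ y ∈ latticeBall c R, y ∈ latticeBall c R' :=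
    fun hRR' y hy => latticeBall_subset hRR' hy
  have hsup : ∀ y ∈ latticeBall c p, ‖edgeFun G i y‖ ≤ kcSupConst M / Real.sqrt p := fun y hy => by
    rw [edgeFun, hGdef, norm_seamGaugeS]
    exact norm_kcObs_le_of_gaugedBulk h hc hG hle hp8 hbulk hM hHw hHb hy hi
  have hS : ∀ y ∈ latticeBall c (2 * (2 * m) + 2), ∀ k : Fin 4, IsSHolAt G (y, k) := by
    intro y hy k
    exact hbulk.isSHolAt_seamGaugeS hc hG hle (hsub (by omega) y hy) (hsub (by omega) _ (add_cornerUnit_mem_latticeBall hy 2))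
      (hsub (by omega) _ (add_cornerUnit_mem_latticeBall hy 3)) k
  have hharm := isLatticeHarmonicOn_edgeFun_of_isSHolAt (G := G) (c := c) (R := 2 * (2 * m)) hS i hi
  have hM0 : 0 ≤ kcSupConst M / Real.sqrt p := div_nonneg (kcSupConst_nonneg M) (Real.sqrt_nonneg _)
  have key := norm_sub_le_of_harmonic_of_norm_le (g := edgeFun G i) (a := a) hq hharm.1 hharm.2 hM0
    (fun y hy => hsup y (by simpa [hp] using hy)) hx j
  simpa [edgeFun, hp] using key

end Literature.Probability.LatticeModels
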